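import Mathlib
import Summits.Ventures.PercRepro2.HCov
import Summits.Ventures.PercRepro2.BHKAvoid
import Summits.Ventures.PercRepro2.ExploreA3
import Summits.Ventures.PercRepro2.RootLeafUSigns
import Summits.Ventures.PercRepro2.RootLeafUHalf
import Summits.Ventures.PercRepro2.RootLeafUCore
import Summits.Ventures.PercRepro2.RootLeafUYA
import Summits.Ventures.PercRepro2.RootLeafUSepIndep
import Summits.Ventures.PercRepro2.RootLeafUSepK
import Summits.Ventures.PercRepro2.RootLeafUSepB
import Summits.Ventures.PercRepro2.RootLeafUSepUB

/-!
# (G4-u) on the class «`u` separates the root `a₂` from `b`», part 2: the `o ∈ K` half closed modulo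
one general inequality (SW2), and the conditional class theorem (blind cell PercRepro2, p4 g8;
S3 (G4-u), proofs/P4-G8-SEP.md §9–§10)
`T2oK = 2pb·{2(1 − Z)·[t′ P(PD,oK) − D P(T′,oK)] + Z·[D η_o − η P(PD,oK)]}` (`SepUB.T2oK_sepUB_eq`;
`η = P(a₂ ↮ c, a₂ ↔ u)`, `η_o = P(a₂ ↮ c, a₂ ↔ u, a₂ ↔ o)`); the first bracket is `≥ 0` by BHK06 Thm 1.4
with the avoided set `{u, c}` (`SepUB.X_nonneg`), so `0 ≤ T2oK` modulo **(SW2)** `η·P(PD,oK) ≤ D·η_o`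
(census 0 / 850 on general instances, P4-G8-SEP.md §10) — `SepUB.T2oK_nonneg_of_sepUB`, and
**`SepUB.HCov_root_leaf_u_of_sepUB`**: (G4-u) on the class, conditional on (SW2) for the instance.
-/

namespace Summit.Ventures.PercRepro2

open UnionCluster CovForm

namespace RootLeafU

namespace SepUB

section SepUBK

variable {V : Type*} {E : Type*} [Fintype E] [DecidableEq E] [Fintype V] [DecidableEq V]
  {R : Type*} [Field R] [LinearOrder R] [IsStrictOrderedRing R]

variable (p : E → R) (ends : E → Sym2 V) (o a₂ c b u : V)

omit [Fintype E] [DecidableEq E] [Fintype V] [DecidableEq V] in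
/-- `T′ ⊆ {a₂ ↮ c}`. -/
lemma TEvent_swap_subset_avoid : TEvent ends a₂ u c ⊆ avoidAll ends a₂ {c} := by
  intro ω hω x hx
  rw [Finset.mem_singleton] at hx
  subst hx
  exact fun h => hω.1 (conn_trans hω.2 (conn_symm h))

omit [Fintype E] [DecidableEq E] [Fintype V] [DecidableEq V] in
/-- `PD ⊆ {a₂ ↮ c}`. -/
lemma PDEvent_subset_avoid : PDEvent ends u a₂ c ⊆ avoidAll ends a₂ {c} := by
  intro ω hω x hx
  rw [Finset.mem_singleton] at hx
  subst hx
  exact fun h => hω.2 (Or.inr (conn_symm h))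

omit [Fintype V] in
/-- `e0 = P(PD, oK) + P(T′, oK) + η_o` (split `{a₂ ↮ c, a₂ ↔ o}` by `a₂ ↔ u`). -/
lemma e0_split :
    prob p (avoidAll ends a₂ {c} ∩ connEvent ends a₂ o) =
      prob p (PDEvent ends u a₂ c ∩ connEvent ends a₂ o) +
        prob p (TEvent ends a₂ u c ∩ connEvent ends a₂ o) +
        prob p (avoidAll ends a₂ {c} ∩ (connEvent ends a₂ u ∩ connEvent ends a₂ o)) := by
  have h := prob_inter_add_prob_inter_compl p (avoidAll ends a₂ {c} ∩ connEvent ends a₂ o)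
    (connEvent ends a₂ u)
  have hs := Qsplit p ends u a₂ c (avoidAll ends a₂ {c} ∩ connEvent ends a₂ o)
  have e1 : avoidAll ends a₂ {c} ∩ connEvent ends a₂ o ∩ (connEvent ends a₂ u)ᶜ =
      avoidAll ends a₂ {u} ∩ (avoidAll ends a₂ {c} ∩ connEvent ends a₂ o) := by
    rw [avoidAll_singleton_eq ends a₂ u]
    ext ω; simp only [Set.mem_inter_iff]; tauto
  have e2 : avoidAll ends a₂ {c} ∩ connEvent ends a₂ o ∩ connEvent ends a₂ u =
      avoidAll ends a₂ {c} ∩ (connEvent ends a₂ u ∩ connEvent ends a₂ o) := by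
    ext ω; simp only [Set.mem_inter_iff]; tauto
  have e3 : PDEvent ends u a₂ c ∩ (avoidAll ends a₂ {c} ∩ connEvent ends a₂ o) =
      PDEvent ends u a₂ c ∩ connEvent ends a₂ o := by
    ext ω
    simp only [Set.mem_inter_iff]
    exact ⟨fun h => ⟨h.1, h.2.2⟩, fun h => ⟨h.1, PDEvent_subset_avoid ends a₂ c u h.1, h.2⟩⟩
  have e4 : TEvent ends u a₂ c ∩ (avoidAll ends a₂ {c} ∩ connEvent ends a₂ o) = ∅ := by
    ext ω
    simp only [Set.mem_inter_iff, Set.mem_empty_iff_false, iff_false, not_and]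
    intro h1 h2 _
    exact h2 c (Finset.mem_singleton_self c) h1.2
  have e5 : TEvent ends a₂ u c ∩ (avoidAll ends a₂ {c} ∩ connEvent ends a₂ o) =
      TEvent ends a₂ u c ∩ connEvent ends a₂ o := by
    ext ω
    simp only [Set.mem_inter_iff]
    exact ⟨fun h => ⟨h.1, h.2.2⟩, fun h => ⟨h.1, TEvent_swap_subset_avoid ends a₂ c u h.1, h.2⟩⟩
  rw [e1, e2] at h
  rw [e3, e4, e5, prob_empty] at hs
  linarith

omit [Fintype V] in
/-- `d0 = D + t′ + η` (split `{a₂ ↮ c}` by `a₂ ↔ u`). -/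
lemma d0_split :
    prob p (avoidAll ends a₂ {c}) =
      prob p (PDEvent ends u a₂ c) + prob p (TEvent ends a₂ u c) +
        prob p (avoidAll ends a₂ {c} ∩ connEvent ends a₂ u) := by
  have h := prob_inter_add_prob_inter_compl p (avoidAll ends a₂ {c}) (connEvent ends a₂ u)
  have hs := Qsplit p ends u a₂ c (avoidAll ends a₂ {c})
  have e1 : avoidAll ends a₂ {c} ∩ (connEvent ends a₂ u)ᶜ = avoidAll ends a₂ {u} ∩ avoidAll ends a₂ {c} := by
    rw [avoidAll_singleton_eq ends a₂ u, Set.inter_comm]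
  have e3 : PDEvent ends u a₂ c ∩ avoidAll ends a₂ {c} = PDEvent ends u a₂ c :=
    Set.inter_eq_left.2 (PDEvent_subset_avoid ends a₂ c u)
  have e4 : TEvent ends u a₂ c ∩ avoidAll ends a₂ {c} = ∅ := by
    ext ω
    simp only [Set.mem_inter_iff, Set.mem_empty_iff_false, iff_false, not_and]
    intro h1 h2
    exact h2 c (Finset.mem_singleton_self c) h1.2
  have e5 : TEvent ends a₂ u c ∩ avoidAll ends a₂ {c} = TEvent ends a₂ u c :=
    Set.inter_eq_left.2 (TEvent_swap_subset_avoid ends a₂ c u)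
  rw [e1] at h
  rw [e3, e4, e5, prob_empty] at hs
  linarith

/-- The `b ∈ L` masses of the `o ∈ K` half combine: `P(PD, oK, bL) + P(T′, oK, bL) = pb · [P(PD,oK) + P(T′,oK)]`. -/
lemma prob_oK_bL_sum (hsep : ∀ ω : Config E, Conn ends ω a₂ b → Conn ends ω a₂ u) (hua : u ≠ a₂) :
    prob p (PDEvent ends u a₂ c ∩ (connEvent ends a₂ o ∩ connEvent ends u b)) +
        prob p (TEvent ends a₂ u c ∩ (connEvent ends a₂ o ∩ connEvent ends u b)) =
      prob p (connEvent ends u b) *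
        (prob p (PDEvent ends u a₂ c ∩ connEvent ends a₂ o) +
          prob p (TEvent ends a₂ u c ∩ connEvent ends a₂ o)) := by
  have hs1 := Qsplit p ends u a₂ c (connEvent ends a₂ o ∩ connEvent ends u b)
  have hs2 := Qsplit p ends u a₂ c (connEvent ends a₂ o)
  have h1 := SepK.prob_Q_clusterInK_conn_eq p ends a₂ b u hsep hua {W | o ∈ W}
  have h2 := SepK.prob_Q_clusterInK_conn_eq p ends a₂ b u hsep hua ({W | c ∈ W} ∩ {W | o ∈ W})
  rw [ExploreA3.clusterInEvent_mem_eq] at h1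
  rw [clusterInEvent_mem_inter_eq] at h2
  have e1 : avoidAll ends a₂ {u} ∩ connEvent ends a₂ o ∩ connEvent ends u b =
      avoidAll ends a₂ {u} ∩ (connEvent ends a₂ o ∩ connEvent ends u b) := Set.inter_assoc _ _ _
  have e2 : avoidAll ends a₂ {u} ∩ (connEvent ends a₂ c ∩ connEvent ends a₂ o) ∩ connEvent ends u b =
      TEvent ends u a₂ c ∩ (connEvent ends a₂ o ∩ connEvent ends u b) := by
    rw [Sep.TEvent_eq ends a₂ c u]
    ext ω; simp only [Set.mem_inter_iff]; tauto
  have e3 : avoidAll ends a₂ {u} ∩ (connEvent ends a₂ c ∩ connEvent ends a₂ o) =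
      TEvent ends u a₂ c ∩ connEvent ends a₂ o := by
    rw [Sep.TEvent_eq ends a₂ c u, Set.inter_assoc]
  rw [e1] at h1
  rw [e2, e3] at h2
  linear_combination -hs1 + h1 - h2 + prob p (connEvent ends u b) * hs2

/-- **The `o ∈ K` half on the class**: `T2oK = 2pb·{2(1 − Z)·[t′ P(PD,oK) − D P(T′,oK)] + Z·[D η_o − η P(PD,oK)]}`
(`η = P(a₂ ↮ c, a₂ ↔ u)`, `η_o = P(a₂ ↮ c, a₂ ↔ u, a₂ ↔ o)`). -/
theorem T2oK_sepUB_eq (hsep : ∀ ω : Config E, Conn ends ω a₂ b → Conn ends ω a₂ u) (hua : u ≠ a₂) :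
    T2oK p ends o a₂ c b u =
      2 * prob p (connEvent ends u b) *
        (2 * (1 - prob p (avoidAll ends a₂ {u})) *
            (prob p (TEvent ends a₂ u c) * prob p (PDEvent ends u a₂ c ∩ connEvent ends a₂ o) -
              prob p (PDEvent ends u a₂ c) * prob p (TEvent ends a₂ u c ∩ connEvent ends a₂ o)) +
          prob p (avoidAll ends a₂ {u}) *
            (prob p (PDEvent ends u a₂ c) *
                prob p (avoidAll ends a₂ {c} ∩ (connEvent ends a₂ u ∩ connEvent ends a₂ o)) -
              prob p (avoidAll ends a₂ {c} ∩ connEvent ends a₂ u) *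
                prob p (PDEvent ends u a₂ c ∩ connEvent ends a₂ o))) := by
  have hgap := gap_eq_Q p ends u a₂ b
  have hbL := Qsplit p ends u a₂ c (connEvent ends u b)
  have hZ := Qsplit_univ p ends u a₂ c
  have z1 : prob p (avoidAll ends a₂ {u} ∩ connEvent ends a₂ b) = 0 :=
    prob_eq_zero_of_subset p ends a₂ b u hsep le_rfl
  have z2 : prob p (TEvent ends a₂ u c ∩ connEvent ends a₂ b) = 0 :=
    prob_eq_zero_of_subset p ends a₂ b u hsep
      (Set.inter_subset_inter_left _ (SepB.TEvent_swap_subset ends a₂ c u))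
  have z3 : prob p (TEvent ends u a₂ c ∩ connEvent ends a₂ b) = 0 :=
    prob_eq_zero_of_subset p ends a₂ b u hsep
      (Set.inter_subset_inter_left _ (SepB.TEvent_subset ends a₂ c u))
  have z4 : prob p (PDEvent ends u a₂ c ∩ connEvent ends a₂ b) = 0 :=
    prob_eq_zero_of_subset p ends a₂ b u hsep
      (Set.inter_subset_inter_left _ (SepB.PDEvent_subset ends a₂ c u))
  have z7 : prob p (TEvent ends a₂ u c ∩ (connEvent ends a₂ o ∩ connEvent ends a₂ b)) = 0 :=
    prob_eq_zero_of_subset p ends a₂ b u hsep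
      (fun ω hω => ⟨SepB.TEvent_swap_subset ends a₂ c u hω.1, hω.2.2⟩)
  have hQbL := prob_Q_bL_eq p ends a₂ b u hsep hua
  have hTbL := prob_T_bL_eq p ends a₂ c b u hsep hua
  have hhb := hb_eq p ends a₂ b u hsep hua
  have hTpbL : prob p (TEvent ends a₂ u c ∩ connEvent ends u b) =
      prob p (connEvent ends u b) * prob p (avoidAll ends a₂ {u}) -
        prob p (connEvent ends u b) * prob p (TEvent ends u a₂ c) -
        prob p (PDEvent ends u a₂ c ∩ connEvent ends u b) := by
    rw [← hQbL, ← hTbL]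
    linarith
  have hsum := prob_oK_bL_sum p ends o a₂ c b u hsep hua
  have hTpoKbL : prob p (TEvent ends a₂ u c ∩ (connEvent ends a₂ o ∩ connEvent ends u b)) =
      prob p (connEvent ends u b) *
        (prob p (PDEvent ends u a₂ c ∩ connEvent ends a₂ o) +
          prob p (TEvent ends a₂ u c ∩ connEvent ends a₂ o)) -
        prob p (PDEvent ends u a₂ c ∩ (connEvent ends a₂ o ∩ connEvent ends u b)) := by
    linarith
  have he0 := e0_split p ends o a₂ c u
  have hd0 := d0_split p ends a₂ c u
  unfold T2oK Ee EQb3 PDb EQ3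
  rw [prob_univ, hgap, z1, z2, z3, z4, z7, hQbL, hTbL, hhb, hTpbL, hTpoKbL, he0, hd0, hZ]
  ring

/-- `X = t′ P(PD,oK) − D P(T′,oK) ≥ 0`: BHK06 Thm 1.4 for the clusters of `a₂` and `u` with the avoided
set `{u, c}` (`bhk_cross_cluster_avoid`). -/
lemma X_nonneg (hp : IsProbVec p) :
    prob p (PDEvent ends u a₂ c) * prob p (TEvent ends a₂ u c ∩ connEvent ends a₂ o) ≤
      prob p (TEvent ends a₂ u c) * prob p (PDEvent ends u a₂ c ∩ connEvent ends a₂ o) := by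
  have hu : u ∈ ({u, c} : Finset V) := by simp
  have h := bhk_cross_cluster_avoid p hp ends a₂ u hu (𝓤 := {W | o ∈ W}) (𝓥 := {W | c ∈ W})
    (fun _ _ h hW => h hW) (fun _ _ h hW => h hW)
  rw [ExploreA3.clusterInEvent_mem_eq, ExploreA3.clusterInEvent_mem_eq] at h
  -- the avoided event `{a₂ ↮ u, a₂ ↮ c} = Q ∩ {a₂ ↮ c}`, with `P = D + t′`
  have hR : avoidAll ends a₂ {u, c} = avoidAll ends a₂ {u} ∩ avoidAll ends a₂ {c} := by
    ext ω
    simp only [avoidAll, Set.mem_setOf_eq, Finset.mem_insert, Finset.mem_singleton, forall_eq_or_imp,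
      forall_eq, Set.mem_inter_iff]
  have hs := Qsplit p ends u a₂ c (avoidAll ends a₂ {c})
  have hso := Qsplit p ends u a₂ c (avoidAll ends a₂ {c} ∩ connEvent ends a₂ o)
  have e1 : connEvent ends a₂ o ∩ connEvent ends u c ∩ avoidAll ends a₂ {u, c} =
      TEvent ends a₂ u c ∩ connEvent ends a₂ o := by
    rw [hR, SepK.TEvent_swap_eq ends a₂ c u]
    ext ω
    simp only [Set.mem_inter_iff, mem_connEvent, avoidAll, Set.mem_setOf_eq, Finset.mem_singleton,
      forall_eq]
    constructor
    · rintro ⟨⟨h1, h2⟩, h3, _⟩; exact ⟨⟨h3, h2⟩, h1⟩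
    · rintro ⟨⟨h3, h2⟩, h1⟩
      exact ⟨⟨h1, h2⟩, h3, fun h => h3 (conn_trans h (conn_symm h2))⟩
  have e2 : connEvent ends u c ∩ avoidAll ends a₂ {u, c} = TEvent ends a₂ u c := by
    rw [hR, SepK.TEvent_swap_eq ends a₂ c u]
    ext ω
    simp only [Set.mem_inter_iff, mem_connEvent, avoidAll, Set.mem_setOf_eq, Finset.mem_singleton,
      forall_eq]
    constructor
    · rintro ⟨h2, h3, _⟩; exact ⟨h3, h2⟩
    · rintro ⟨h3, h2⟩; exact ⟨h2, h3, fun h => h3 (conn_trans h (conn_symm h2))⟩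
  have e3 : connEvent ends a₂ o ∩ avoidAll ends a₂ {u, c} =
      avoidAll ends a₂ {u} ∩ (avoidAll ends a₂ {c} ∩ connEvent ends a₂ o) := by
    rw [hR]; ext ω; simp only [Set.mem_inter_iff]; tauto
  rw [e1, e2, e3, hR] at h
  -- `P(Q ∩ {a₂ ↮ c}) = D + t′` and `P(Q, a₂ ↮ c, oK) = P(PD, oK) + P(T′, oK)`
  have f3 : PDEvent ends u a₂ c ∩ avoidAll ends a₂ {c} = PDEvent ends u a₂ c :=
    Set.inter_eq_left.2 (PDEvent_subset_avoid ends a₂ c u)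
  have f4 : TEvent ends u a₂ c ∩ avoidAll ends a₂ {c} = ∅ := by
    ext ω
    simp only [Set.mem_inter_iff, Set.mem_empty_iff_false, iff_false, not_and]
    intro h1 h2
    exact h2 c (Finset.mem_singleton_self c) h1.2
  have f5 : TEvent ends a₂ u c ∩ avoidAll ends a₂ {c} = TEvent ends a₂ u c :=
    Set.inter_eq_left.2 (TEvent_swap_subset_avoid ends a₂ c u)
  have g3 : PDEvent ends u a₂ c ∩ (avoidAll ends a₂ {c} ∩ connEvent ends a₂ o) =
      PDEvent ends u a₂ c ∩ connEvent ends a₂ o := by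
    ext ω
    simp only [Set.mem_inter_iff]
    exact ⟨fun h => ⟨h.1, h.2.2⟩, fun h => ⟨h.1, PDEvent_subset_avoid ends a₂ c u h.1, h.2⟩⟩
  have g4 : TEvent ends u a₂ c ∩ (avoidAll ends a₂ {c} ∩ connEvent ends a₂ o) = ∅ := by
    ext ω
    simp only [Set.mem_inter_iff, Set.mem_empty_iff_false, iff_false, not_and]
    intro h1 h2 _
    exact h2 c (Finset.mem_singleton_self c) h1.2
  have g5 : TEvent ends a₂ u c ∩ (avoidAll ends a₂ {c} ∩ connEvent ends a₂ o) =
      TEvent ends a₂ u c ∩ connEvent ends a₂ o := by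
    ext ω
    simp only [Set.mem_inter_iff]
    exact ⟨fun h => ⟨h.1, h.2.2⟩, fun h => ⟨h.1, TEvent_swap_subset_avoid ends a₂ c u h.1, h.2⟩⟩
  rw [f3, f4, f5, prob_empty] at hs
  rw [g3, g4, g5, prob_empty] at hso
  rw [hs, hso] at h
  nlinarith [h]

/-- **The `o ∈ K` half is non-negative on the class, modulo (SW2)** `η · P(PD,oK) ≤ D · η_o`. -/
theorem T2oK_nonneg_of_sepUB (hp : IsProbVec p)
    (hsep : ∀ ω : Config E, Conn ends ω a₂ b → Conn ends ω a₂ u) (hua : u ≠ a₂)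
    (hSW2 : prob p (avoidAll ends a₂ {c} ∩ connEvent ends a₂ u) *
        prob p (PDEvent ends u a₂ c ∩ connEvent ends a₂ o) ≤
      prob p (PDEvent ends u a₂ c) *
        prob p (avoidAll ends a₂ {c} ∩ (connEvent ends a₂ u ∩ connEvent ends a₂ o))) :
    0 ≤ T2oK p ends o a₂ c b u := by
  rw [T2oK_sepUB_eq p ends o a₂ c b u hsep hua]
  have hX := X_nonneg p ends o a₂ c u hp
  have hpb : 0 ≤ prob p (connEvent ends u b) := prob_nonneg hp _
  have hZ0 : 0 ≤ prob p (avoidAll ends a₂ {u}) := prob_nonneg hp _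
  have hZ1 : prob p (avoidAll ends a₂ {u}) ≤ 1 := prob_le_one hp _
  refine mul_nonneg (mul_nonneg (by norm_num) hpb) (add_nonneg ?_ ?_)
  · exact mul_nonneg (mul_nonneg (by norm_num) (by linarith)) (by linarith)
  · exact mul_nonneg hZ0 (by linarith)

/-- **`0 ≤ T2` on the class, modulo (SW2).** -/
theorem T2_nonneg_of_sepUB (hp : IsProbVec p)
    (hsep : ∀ ω : Config E, Conn ends ω a₂ b → Conn ends ω a₂ u) (hua : u ≠ a₂)
    (hSW2 : prob p (avoidAll ends a₂ {c} ∩ connEvent ends a₂ u) *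
        prob p (PDEvent ends u a₂ c ∩ connEvent ends a₂ o) ≤
      prob p (PDEvent ends u a₂ c) *
        prob p (avoidAll ends a₂ {c} ∩ (connEvent ends a₂ u ∩ connEvent ends a₂ o))) :
    0 ≤ T2 p ends o a₂ c b u :=
  T2_nonneg_of_halves p ends o a₂ c b u (T2oL_nonneg_of_sepUB p ends o a₂ c b u hp hsep hua)
    (T2oK_nonneg_of_sepUB p ends o a₂ c b u hp hsep hua hSW2)

/-- **(G4-u) on the class «`u` separates `a₂` from `b`», modulo (SW2)**: for the root `a₁` a leaf at
the unmarked vertex `u` (edge `f`), if every configuration with `a₂ ↔ b` has `a₂ ↔ u`, and the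
instance satisfies (SW2) `P(a₂ ↮ c, a₂ ↔ u)·P(PD, o ∈ K) ≤ P(PD)·P(a₂ ↮ c, a₂ ↔ u, a₂ ↔ o)`, then
(HCOV) for the root-leaf instance follows from (HCOV) for the instance `a₁ := u`. -/
theorem HCov_root_leaf_u_of_sepUB (hp : IsProbVec p) {f : E} {a₁ : V} (hf : ends f = s(a₁, u))
    (hleaf : ∀ e, a₁ ∈ ends e → e = f) (h1u : a₁ ≠ u) (h12 : a₁ ≠ a₂) (h1c : a₁ ≠ c)
    (h1o : a₁ ≠ o) (h1b : a₁ ≠ b) (hua : u ≠ a₂)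
    (hsep : ∀ ω : Config E, Conn ends ω a₂ b → Conn ends ω a₂ u)
    (hSW2 : prob p (avoidAll ends a₂ {c} ∩ connEvent ends a₂ u) *
        prob p (PDEvent ends u a₂ c ∩ connEvent ends a₂ o) ≤
      prob p (PDEvent ends u a₂ c) *
        prob p (avoidAll ends a₂ {c} ∩ (connEvent ends a₂ u ∩ connEvent ends a₂ o)))
    (h3 : HCov p ends o u a₂ c b) : HCov p ends o a₁ a₂ c b :=
  HCov_root_leaf_u_of p ends hp hf hleaf h1u h12 h1c h1o h1b
    (T2_nonneg_of_sepUB p ends o a₂ c b u hp hsep hua hSW2) h3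

end SepUBK

end SepUB

end RootLeafU

end Summit.Ventures.PercRepro2
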